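import Summits.RiemannHypothesis.RiemannHypothesis.Theorems.GroundBartaEvenWinsBeyondArchDeflationSliverEdge
import Literature.NumberTheory.LFunctions.WeilFinitePrimeSliver
import HarnessLib

/-!
# RiemannHypothesis / GroundBarta — rung 4 (`EvenWinsBeyondArch`, stmt-RiemannHypothesis-18807 / 18085):
# the multi-prime sliver charges only the EDGE masses — windows beyond `(log 5)/2`

Helper file (`--supports stmt-RiemannHypothesis-18085`), RH-free, no definitions, no named facts.  Prover A (gen 11
of unit `sr-gb-rung-a`).

Beyond the three-prime endpoint `(log 5)/2` the prime power `5` (and, past `(log 7)/2`, `7`, `8`, …) enters the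
window.  The two-prime certificate format (`WeilCert23`, level `β₂₃`) still certifies the TRUE form there, every newly
visible prime power `n > 3` being charged by the sliver bound; this file gives the POINTWISE (edge) form of that charge
for any number of prime powers, generalising `…DeflationSliverEdge` (`n = 4` only, `c ≤ (log 5)/2`):

* `dt_weilFinitePrimeQuadratic_sub_edges_le` — for `tsupport g ⊆ [-c, c]`, `c < log (M+1)`, `M ≤ N` and thresholds
  `y n ≤ log n − c`:  `E_M(g) − Σ_{M < n ≤ N} (Λ(n)/√n) ∫_{|u| ≥ y n} |g|² ≤ E_N(g)`
  (each shift `log n > c` sees only the edge mass `|u| ≥ log n − c`, `dt_norm_weilConv_weilReflect_add_neg_le_edge`);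
* `dt_weilFinitePrimeQuadratic_sub_edges_le_weilQuadratic_re` — the same against `Re Q(g)` when `c ≤ (log (N+1))/2`;
* **`dt_weilTwoPrimeQuadratic_sub_edges45_le_weilQuadratic_re`** — the `{2,3,4,5}`-window form used by the next cells:
  for `c ≤ (log 7)/2`, `y₄ ≤ log 4 − c`, `y₅ ≤ log 5 − c`,
  `E₂₃(g) − (log 2)/2 · ∫_{|u| ≥ y₄} |g|² − (log 5/√5) · ∫_{|u| ≥ y₅} |g|² ≤ Re Q(g)`
  (`Λ(6) = 0`: the window may run up to the prime `7`).

So a two-prime certificate at level `β₂₃` certifies the true form on a window `c ≤ (log 7)/2` with the POINTWISE level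
`β₂₃ − (log 2)/2 · 𝟙_{|u| ≥ y₄} − (log 5/√5) · 𝟙_{|u| ≥ y₅}` — the input of the three-zone weighted deflated Temple
criterion (`…DeflationCertBridgeWXA45`).
-/

set_option linter.dupNamespace false

noncomputable section

open Complex Filter Set MeasureTheory
open scoped Real Topology ComplexConjugate BigOperators

namespace Summit.RiemannHypothesis.RiemannHypothesis.Theorems.EvenWinsBeyondArch

open Literature.NumberTheory.LFunctions

variable {g : ℝ → ℂ}

/-- **Multi-prime sliver, edge form.** For `tsupport g ⊆ [-c, c]`, `c < log (M+1)`, `M ≤ N` and any thresholds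
`y n ≤ log n − c` (`M < n ≤ N`):  `E_M(g) − Σ_{M < n ≤ N} (Λ(n)/√n) · ∫_{|u| ≥ y n} |g|² ≤ E_N(g)`. [folklore] -/
theorem dt_weilFinitePrimeQuadratic_sub_edges_le (hg : IsWeilTest g) {c : ℝ} (hsupp : tsupport g ⊆ Icc (-c) c)
    {M N : ℕ} (hMN : M ≤ N) (hc : c < Real.log ((M : ℝ) + 1)) (y : ℕ → ℝ)
    (hy : ∀ n ∈ Finset.Ioc M N, y n ≤ Real.log (n : ℝ) - c) :
    weilFinitePrimeQuadratic M g -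
        ∑ n ∈ Finset.Ioc M N, (ArithmeticFunction.vonMangoldt n : ℝ) / Real.sqrt (n : ℝ) *
          ∫ u : ℝ, {u : ℝ | y n ≤ |u|}.indicator (fun u ↦ ‖g u‖ ^ 2) u ≤
      weilFinitePrimeQuadratic N g := by
  have hsub := weilFinitePrimeQuadratic_sub_eq_neg_sum hg hMN
  -- termwise: (Λ(n)/√n) · Re(k(log n) + k(−log n)) ≤ (Λ(n)/√n) · ∫_{|u| ≥ y n} |g|²
  have hterm : ∀ n ∈ Finset.Ioc M N,
      (ArithmeticFunction.vonMangoldt n : ℝ) / Real.sqrt (n : ℝ) *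
          (weilConv g (weilReflect g) (Real.log (n : ℝ)) + weilConv g (weilReflect g) (-Real.log (n : ℝ))).re ≤
        (ArithmeticFunction.vonMangoldt n : ℝ) / Real.sqrt (n : ℝ) *
          ∫ u : ℝ, {u : ℝ | y n ≤ |u|}.indicator (fun u ↦ ‖g u‖ ^ 2) u := by
    intro n hn
    have hn1 : M + 1 ≤ n := (Finset.mem_Ioc.mp hn).1
    have hcn : c < Real.log (n : ℝ) := by
      refine hc.trans_le (Real.log_le_log (by positivity) ?_)
      exact_mod_cast hn1
    have hL : 0 ≤ (ArithmeticFunction.vonMangoldt n : ℝ) / Real.sqrt (n : ℝ) :=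
      div_nonneg ArithmeticFunction.vonMangoldt_nonneg (Real.sqrt_nonneg _)
    have hk := dt_norm_weilConv_weilReflect_add_neg_le_edge hg hsupp hcn
    have hre := Complex.re_le_norm
      (weilConv g (weilReflect g) (Real.log (n : ℝ)) + weilConv g (weilReflect g) (-Real.log (n : ℝ)))
    have hmono := dt_edgeMass_mono hg (hy n hn)
    exact mul_le_mul_of_nonneg_left (hre.trans (hk.trans hmono)) hL
  have hsum := Finset.sum_le_sum hterm
  linarith [hsub, hsum]

/-- **Multi-prime sliver, edge form, against Weil's functional.** For `tsupport g ⊆ [-c, c]`, `c < log (M+1)`,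
`c ≤ (log (N+1))/2`, `M ≤ N`, thresholds `y n ≤ log n − c`:
`E_M(g) − Σ_{M < n ≤ N} (Λ(n)/√n) · ∫_{|u| ≥ y n} |g|² ≤ Re Q(g)`. [folklore] -/
theorem dt_weilFinitePrimeQuadratic_sub_edges_le_weilQuadratic_re (hg : IsWeilTest g) {c : ℝ}
    (hsupp : tsupport g ⊆ Icc (-c) c) {M N : ℕ} (hMN : M ≤ N) (hcM : c < Real.log ((M : ℝ) + 1))
    (hcN : c ≤ Real.log ((N : ℝ) + 1) / 2) (y : ℕ → ℝ)
    (hy : ∀ n ∈ Finset.Ioc M N, y n ≤ Real.log (n : ℝ) - c) :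
    weilFinitePrimeQuadratic M g -
        ∑ n ∈ Finset.Ioc M N, (ArithmeticFunction.vonMangoldt n : ℝ) / Real.sqrt (n : ℝ) *
          ∫ u : ℝ, {u : ℝ | y n ≤ |u|}.indicator (fun u ↦ ‖g u‖ ^ 2) u ≤
      (weilQuadratic g).re := by
  have hsupp' : tsupport g ⊆ Icc (-(Real.log ((N : ℝ) + 1) / 2)) (Real.log ((N : ℝ) + 1) / 2) :=
    hsupp.trans (Icc_subset_Icc (by linarith) hcN)
  rw [weilQuadratic_re_eq_weilFinitePrimeQuadratic hg N hsupp']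
  exact dt_weilFinitePrimeQuadratic_sub_edges_le hg hsupp hMN hcM y hy

/-- `(log 7)/2 < log 4` (the `{2,…,6}`-window sits below the two-prime format's limit `log 4`). [folklore] -/
theorem dt_log_seven_half_lt_log_four : Real.log 7 / 2 < Real.log 4 := by
  have h7 : Real.log 7 < Real.log 16 := Real.log_lt_log (by norm_num) (by norm_num)
  have h16 : Real.log 16 = 2 * Real.log 4 := by
    rw [show (16 : ℝ) = 4 ^ 2 by norm_num, Real.log_pow]; push_cast; ring
  linarith

/-- **Pointwise-level form of the sliver on the `{2,3,4,5}`-window** (prime powers `2, 3, 4, 5` visible; `Λ(6) = 0`):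
for `tsupport g ⊆ [-c, c]`, `c ≤ (log 7)/2` and thresholds `y₄ ≤ log 4 − c`, `y₅ ≤ log 5 − c`,
`E₂₃(g) − (log 2)/2 · ∫_{|u| ≥ y₄} |g|² − (log 5/√5) · ∫_{|u| ≥ y₅} |g|² ≤ Re Q(g)`. [folklore] -/
theorem dt_weilTwoPrimeQuadratic_sub_edges45_le_weilQuadratic_re (hg : IsWeilTest g) {c : ℝ}
    (hsupp : tsupport g ⊆ Icc (-c) c) (hc7 : c ≤ Real.log 7 / 2) {y₄ y₅ : ℝ}
    (hy₄ : y₄ ≤ Real.log 4 - c) (hy₅ : y₅ ≤ Real.log 5 - c) :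
    weilTwoPrimeQuadratic g - Real.log 2 / 2 * (∫ u : ℝ, {u : ℝ | y₄ ≤ |u|}.indicator (fun u ↦ ‖g u‖ ^ 2) u) -
        Real.log 5 / Real.sqrt 5 * (∫ u : ℝ, {u : ℝ | y₅ ≤ |u|}.indicator (fun u ↦ ‖g u‖ ^ 2) u) ≤
      (weilQuadratic g).re := by
  -- thresholds: y 4 = y₄, y 5 = y₅, y 6 = anything (Λ(6) = 0)
  set y : ℕ → ℝ := fun n ↦ if n = 4 then y₄ else if n = 5 then y₅ else Real.log 6 - c with hydef
  have hcM' : c < Real.log (((3 : ℕ) : ℝ) + 1) := by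
    have h := dt_log_seven_half_lt_log_four
    have e : (((3 : ℕ) : ℝ) + 1) = 4 := by norm_num
    rw [e]; linarith
  have hcN : c ≤ Real.log (((6 : ℕ) : ℝ) + 1) / 2 := by
    have e : (((6 : ℕ) : ℝ) + 1) = 7 := by norm_num
    rw [e]; exact hc7
  have hy : ∀ n ∈ Finset.Ioc 3 6, y n ≤ Real.log (n : ℝ) - c := by
    intro n hn
    have hn' : n = 4 ∨ n = 5 ∨ n = 6 := by
      have h1 := (Finset.mem_Ioc.mp hn).1; have h2 := (Finset.mem_Ioc.mp hn).2; omega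
    rcases hn' with rfl | rfl | rfl
    · simp only [hydef, if_true]; push_cast; exact hy₄
    · simp only [hydef, show (5 : ℕ) ≠ 4 by norm_num, if_false, if_true]; push_cast; exact hy₅
    · simp only [hydef, show (6 : ℕ) ≠ 4 by norm_num, show (6 : ℕ) ≠ 5 by norm_num, if_false]; push_cast
      exact le_rfl
  have h := dt_weilFinitePrimeQuadratic_sub_edges_le_weilQuadratic_re hg hsupp (by norm_num : 3 ≤ 6) hcM' hcN y hy
  -- evaluate the sum over `{4, 5, 6}`
  have hIoc : Finset.Ioc 3 6 = {4, 5, 6} := by decide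
  rw [hIoc, Finset.sum_insert (by decide), Finset.sum_insert (by decide), Finset.sum_singleton,
    weilFinitePrimeQuadratic_three] at h
  have h4 : (ArithmeticFunction.vonMangoldt 4 : ℝ) / Real.sqrt ((4 : ℕ) : ℝ) = Real.log 2 / 2 := by
    rw [vonMangoldt_four, sqrt_four_eq_two]
  have h5 : (ArithmeticFunction.vonMangoldt 5 : ℝ) / Real.sqrt ((5 : ℕ) : ℝ) = Real.log 5 / Real.sqrt 5 := by
    rw [vonMangoldt_five]; push_cast; ring
  have h6 : (ArithmeticFunction.vonMangoldt 6 : ℝ) / Real.sqrt ((6 : ℕ) : ℝ) = 0 := by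
    rw [vonMangoldt_six, zero_div]
  have hy4 : y 4 = y₄ := by simp [hydef]
  have hy5 : y 5 = y₅ := by simp [hydef]
  rw [h4, h5, h6, hy4, hy5, zero_mul, add_zero] at h
  linarith

end Summit.RiemannHypothesis.RiemannHypothesis.Theorems.EvenWinsBeyondArch

end
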